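import Summits.BirchSwinnertonDyer.BirchSwinnertonDyer.Theorems.ResidualThetaTransportAtTwoThetaLayerLambdaCongruenceAtTwoStarFourCosets
import Literature.NumberTheory.EllipticCurves.ModularJacobianTorsionHeckeSelfDual
import HarnessLib

/-!
# Crux Kan⁺ `ThetaLayerLambdaCongruenceAtTwo` (stmt-BirchSwinnertonDyer-20688), line `birth`: SOCLE FROM COSOCLE — mod-`2`
# multiplicity one in SUB form (`dim_{𝕋/𝔪} J₀(L)[𝔪] = 2`) from the QUOTIENT form (`dim_{𝕋/𝔪} Λ/𝔪Λ = 2`) and the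
# 𝕋-balanced left-nondegenerate pairing on `J₀(L)[2]` (the consumed shape of `heckeSelfDual_torsionBy_J0` at `ℓ = 2`)

Cell `bsd-wall`, LEAD prover `bsd-wall-rtt-p3` g12 (`--supports stmt-BirchSwinnertonDyer-20688`; THEOREMS ONLY — no `def`, no named
fact introduced, no `sorry`). BSD is not proved by this; nothing here closes an item.

WHY. The tree holds Buzzard 2000 Prop. 2.4 in SUB form on the uniformisation model (`buzzard2000_multiplicityOne_gamma0`:
`dim_{𝕋/𝔪} J₀(N)[𝔪] = 2`), converted to the QUOTIENT form `|Λ/𝔪Λ| ≤ 4` consumed by (K2) through the pairing of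
`heckeSelfDual_torsionBy_J0` (`exists_fourCosets_periodHomology_of_multiplicityOne`, `…StarFourCosets` §2: `|M/𝔪M| ≤ |M[𝔪]|`). The
printed object `J(Γ)[𝔪]` (`T` via Picard functoriality) is, on the Kummer model `J[2] = H¹(X(ℂ), μ₂) = Hom(Λ, ℤ/2)`, the quotient form
itself (rtt-p3-w3 g10 `…CosocleRoad` / `…CosocleKanPlus`: Kan⁺ ⟸ that statement alone; review p648238: the reading is sound, ONE named
fact per printed result ⇒ «replacement, not addition»). If the programme re-types the ONE Buzzard fact in the quotient reading, the
tree's three SOCLE consumers (`…StarGalois.finrank_torsionBySet_eq_two_of_facts`, `…RPlusLineThreeFacts.finrank_torsionBySet_eq_two_of_buzzard`,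
`…SignedMuVanishingAtTwoPlusMultOneSocle`) must regain the sub form from {quotient form, SD-pairing} — THIS FILE is that converse
bridge, landed ahead of any typing decision (it is a theorem either way):
* §1 `natCard_torsionBySet_le_natCard_quotient_of_pairing` — `|M[I]| ≤ |M/IM|` for a finite `R`-module `M` killed by `2` with a
  balanced pairing of trivial LEFT kernel (the direction converse to `…StarFourCosets.natCard_quotient_smul_top_le_of_pairing`; only
  the left kernel is used: `x ↦ B(x,·)` injects `M[I]` into `Hom(M/IM, ℤ/2)`), and `natCard_torsionBySet_eq_natCard_quotient_of_pairing`;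
* §2 `natCard_quotient_periodHomologyHecke_eq` — `|Λ/𝔪Λ| = |M/𝔪M|` for `M = J₀(L)[2]`, `2 ∈ 𝔪` (`x ↦ [x/2]` is onto with kernel `2Λ`);
* §3 **`finrank_torsionBySet_eq_two_of_cosocle_of_pairing`** — for `𝔪 ∋ 2` maximal with `|𝕋/𝔪| = 2`: `dim_{𝕋/𝔪} Λ/𝔪Λ = 2` and a
  balanced left-nondegenerate pairing on `J₀(L)[2]` give `dim_{𝕋/𝔪} J₀(L)[𝔪] = 2`; **`finrank_torsionBySet_eq_two_of_cosocle_of_sd`**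
  — the same keyed to the named fact `heckeSelfDual_torsionBy_J0` (which every caller of the three socle sites already holds).

References: Darmon–Diamond–Taylor (1995) §1.6 Lemma 1.38, §4.5 Thm. 4.26 [DarmonDiamondTaylor1995]; Buzzard, MRL 7 (2000) Prop. 2.4
[Buzzard2000LevelLoweringModTwo]; Ribet–Stein, *Lectures on Serre's conjectures* §2.3.1.1 [RibetStein2008].
-/

noncomputable section

-- justification: the `Summit.BirchSwinnertonDyer.BirchSwinnertonDyer.…` path repeats a component (route-file convention)
set_option linter.dupNamespace false
set_option autoImplicit false

open scoped MatrixGroups ModularForm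

open CongruenceSubgroup
open Literature.NumberTheory.EllipticCurves Literature.NumberTheory.EllipticCurves.ModularForms

namespace Summit.BirchSwinnertonDyer.BirchSwinnertonDyer.Theorems.ThetaLayerLambdaCongruenceAtTwo

/-! ## §1 `|M[I]| ≤ |M/IM|` from a balanced pairing with trivial left kernel -/

section Pairing

variable {R M : Type*} [CommRing R] [AddCommGroup M] [Module R M]

/-- **`|M[I]| ≤ |M/IM|` from a balanced pairing.** `M` a finite `R`-module killed by `2`, `B : M × M → ℤ/2` biadditive with
`B(t x, y) = B(x, t y)` and trivial left kernel, `I` an ideal. For `x ∈ M[I]` the functional `B(x,·)` kills `IM`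
(`B(x, t y) = B(t x, y) = 0`), so it factors through `M/IM`; `x ↦ B(x,·)` is injective; and `|Hom(M/IM, ℤ/2)| = |M/IM|`
(`natCard_addMonoidHom_zmod_two`). [cite: DarmonDiamondTaylor1995, §4.5 (p. 134)] -/
theorem natCard_torsionBySet_le_natCard_quotient_of_pairing [Finite M] (h2 : ∀ x : M, (2 : ℕ) • x = 0)
    (B : M →+ (M →+ ZMod 2)) (hbal : ∀ (t : R) (x y : M), B (t • x) y = B x (t • y))
    (hleft : ∀ x : M, B x = 0 → x = 0) (I : Ideal R) :
    Nat.card {x : M // ∀ t ∈ I, t • x = 0} ≤ Nat.card (M ⧸ (I • ⊤ : Submodule R M)) := by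
  classical
  set N : Submodule R M := I • ⊤ with hN
  haveI : Finite (M ⧸ N) := Finite.of_surjective _ (Submodule.Quotient.mk_surjective N)
  have h2Q : ∀ q : M ⧸ N, (2 : ℕ) • q = 0 := fun q ↦ by
    obtain ⟨x, rfl⟩ := Submodule.Quotient.mk_surjective N q
    rw [← Submodule.mkQ_apply, ← map_nsmul, h2 x, map_zero]
  rw [← natCard_addMonoidHom_zmod_two h2Q]
  -- `B x` kills `N = IM` for `x ∈ M[I]`
  have hkill : ∀ x : {x : M // ∀ t ∈ I, t • x = 0}, ∀ n ∈ N, B (x : M) n = 0 := by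
    intro x n hn
    refine Submodule.smul_induction_on hn (fun t ht m _ ↦ ?_) (fun a b ha hb ↦ ?_)
    · rw [← hbal, x.2 t ht, map_zero, AddMonoidHom.zero_apply]
    · rw [map_add, ha, hb, add_zero]
  -- the lift of `B x` to `M/N`
  let F : {x : M // ∀ t ∈ I, t • x = 0} → (M ⧸ N →+ ZMod 2) := fun x ↦
    QuotientAddGroup.lift N.toAddSubgroup (B (x : M)) (fun n hn ↦ hkill x n hn)
  have hF : ∀ (x : {x : M // ∀ t ∈ I, t • x = 0}) (m : M), F x (Submodule.Quotient.mk m) = B (x : M) m := fun x m ↦ rfl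
  have hFinj : Function.Injective F := by
    intro x₁ x₂ h
    apply Subtype.ext
    rw [← sub_eq_zero]
    apply hleft
    ext m
    rw [map_sub, AddMonoidHom.sub_apply, ← hF x₁ m, ← hF x₂ m, h, sub_self, AddMonoidHom.zero_apply]
  haveI : Finite (M ⧸ N →+ ZMod 2) :=
    Finite.of_injective (fun f : M ⧸ N →+ ZMod 2 ↦ (⇑f : M ⧸ N → ZMod 2)) DFunLike.coe_injective
  exact Nat.card_le_card_of_injective F hFinj

/-- **`|M[I]| = |M/IM|`** for a finite `R`-module killed by `2` with a balanced pairing of trivial left kernel (both inequalities: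
`…StarFourCosets.natCard_quotient_smul_top_le_of_pairing` and `natCard_torsionBySet_le_natCard_quotient_of_pairing`).
[cite: DarmonDiamondTaylor1995, §4.5 Thm. 4.26 (the two displays agree)] -/
theorem natCard_torsionBySet_eq_natCard_quotient_of_pairing [Finite M] (h2 : ∀ x : M, (2 : ℕ) • x = 0)
    (B : M →+ (M →+ ZMod 2)) (hbal : ∀ (t : R) (x y : M), B (t • x) y = B x (t • y))
    (hleft : ∀ x : M, B x = 0 → x = 0) (I : Ideal R) :
    Nat.card {x : M // ∀ t ∈ I, t • x = 0} = Nat.card (M ⧸ (I • ⊤ : Submodule R M)) :=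
  le_antisymm (natCard_torsionBySet_le_natCard_quotient_of_pairing h2 B hbal hleft I)
    (natCard_quotient_smul_top_le_of_pairing h2 B hbal hleft I)

end Pairing

/-! ## §2 `|Λ/𝔪Λ| = |M/𝔪M|` for `M = J₀(L)[2]`, `2 ∈ 𝔪` -/

section PeriodHomology

variable {L : ℕ} [NeZero L]

/-- **`Λ/𝔪Λ ≅ J₀(L)[2]/𝔪·J₀(L)[2]` (cardinalities)** for an ideal `𝔪 ∋ 2` of `𝕋 = HeckeRing0 L 2`: the `𝕋`-linear map
`Λ → J₀(L)[2]`, `x ↦ [x/2]` (`J0.divMap`) is onto with kernel `2Λ ⊆ 𝔪Λ`, so it induces a bijection `Λ/𝔪Λ → M/𝔪M`. Both quotients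
are finite. [cite: DarmonDiamondTaylor1995, §1.3 (pp. 27–28) (`J[ℓ] = ℓ⁻¹Λ/Λ`)] -/
theorem finite_and_natCard_quotient_periodHomologyHecke_eq (𝔪 : Ideal (HeckeRing0 L 2)) (h2 : (2 : HeckeRing0 L 2) ∈ 𝔪) :
    Finite ((periodHomologyHecke L) ⧸ (𝔪 • ⊤ : Submodule (HeckeRing0 L 2) (periodHomologyHecke L))) ∧
    Nat.card ((periodHomologyHecke L) ⧸ (𝔪 • ⊤ : Submodule (HeckeRing0 L 2) (periodHomologyHecke L))) =
      Nat.card ((Submodule.torsionBy (HeckeRing0 L 2) (J0 L) ((2 : ℕ) : HeckeRing0 L 2)) ⧸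
        (𝔪 • ⊤ : Submodule (HeckeRing0 L 2) (Submodule.torsionBy (HeckeRing0 L 2) (J0 L) ((2 : ℕ) : HeckeRing0 L 2)))) := by
  classical
  haveI hMfin : Finite (Submodule.torsionBy (HeckeRing0 L 2) (J0 L) ((2 : ℕ) : HeckeRing0 L 2)) :=
    J0.finite_torsionBy L (ℓ := 2) two_ne_zero
  have h22 : ((2 : ℕ) : HeckeRing0 L 2) = 2 := Nat.cast_ofNat
  -- the `𝕋`-linear map `Λ → M`, `x ↦ [x/2]`
  let D : (periodHomologyHecke L) →ₗ[HeckeRing0 L 2] (Submodule.torsionBy (HeckeRing0 L 2) (J0 L) ((2 : ℕ) : HeckeRing0 L 2)) :=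
    { toFun := fun x ↦ ⟨J0.divMap L 2 ⟨x, (mem_periodHomologyHecke L).mp x.2⟩, by
        rw [Submodule.mem_torsionBy_iff, Nat.cast_smul_eq_nsmul]
        exact J0.nsmul_divMap L 2 _⟩
      map_add' := fun x y ↦ by
        apply Subtype.ext
        change J0.divMap L 2 ⟨(x : Module.Dual ℂ (CuspForm (Gamma0 L) 2)) + (y : Module.Dual ℂ (CuspForm (Gamma0 L) 2)), _⟩ =
          J0.divMap L 2 _ + J0.divMap L 2 _
        rw [← map_add]
        rfl
      map_smul' := fun t x ↦ by
        apply Subtype.ext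
        change Submodule.Quotient.mk ((2 : ℂ)⁻¹ • (t • (x : Module.Dual ℂ (CuspForm (Gamma0 L) 2)))) =
          t • Submodule.Quotient.mk ((2 : ℂ)⁻¹ • (x : Module.Dual ℂ (CuspForm (Gamma0 L) 2)))
        rw [← Submodule.Quotient.mk_smul, heckeRing0_smul_complex_smul] }
  have hDval : ∀ x : (periodHomologyHecke L),
      ((D x : (Submodule.torsionBy (HeckeRing0 L 2) (J0 L) ((2 : ℕ) : HeckeRing0 L 2))) : J0 L) =
        Submodule.Quotient.mk ((2 : ℂ)⁻¹ • (x : Module.Dual ℂ _)) := fun x ↦ rfl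
  have hDsurj : Function.Surjective D := by
    intro m
    have hm : (m : J0 L) ∈ Submodule.torsionBy (HeckeRing0 L 2) (J0 L) (2 : ℕ) := m.2
    obtain ⟨y, hy⟩ := J0.mem_range_divMap L two_ne_zero hm
    refine ⟨⟨y, (mem_periodHomologyHecke L).mpr y.2⟩, Subtype.ext ?_⟩
    rw [← hy]
    rfl
  have hDker : ∀ z : (periodHomologyHecke L), D z = 0 → z ∈ (𝔪 • ⊤ : Submodule (HeckeRing0 L 2) (periodHomologyHecke L)) := by
    intro z hz
    have hz' : Submodule.Quotient.mk (p := periodHomologyHecke L) ((2 : ℂ)⁻¹ • (z : Module.Dual ℂ _)) = 0 := by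
      rw [← hDval, hz]; rfl
    rw [Submodule.Quotient.mk_eq_zero] at hz'
    have hzw : z = (2 : HeckeRing0 L 2) • (⟨(2 : ℂ)⁻¹ • (z : Module.Dual ℂ _), hz'⟩ : (periodHomologyHecke L)) := by
      apply Subtype.ext
      rw [Submodule.coe_smul, show (2 : HeckeRing0 L 2) = ((2 : ℕ) : HeckeRing0 L 2) from h22.symm, Nat.cast_smul_eq_nsmul,
        ← Nat.cast_smul_eq_nsmul ℂ, smul_smul]
      norm_num
    rw [hzw]
    exact Submodule.smul_mem_smul h2 Submodule.mem_top
  have hmaple : Submodule.map D (𝔪 • ⊤ : Submodule (HeckeRing0 L 2) (periodHomologyHecke L)) =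
      (𝔪 • ⊤ : Submodule (HeckeRing0 L 2) (Submodule.torsionBy (HeckeRing0 L 2) (J0 L) ((2 : ℕ) : HeckeRing0 L 2))) := by
    rw [Submodule.map_smul'', Submodule.map_top, LinearMap.range_eq_top.mpr hDsurj]
  have hinj : ∀ x : (periodHomologyHecke L),
      D x ∈ (𝔪 • ⊤ : Submodule (HeckeRing0 L 2) (Submodule.torsionBy (HeckeRing0 L 2) (J0 L) ((2 : ℕ) : HeckeRing0 L 2))) →
        x ∈ (𝔪 • ⊤ : Submodule (HeckeRing0 L 2) (periodHomologyHecke L)) := by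
    intro x hx
    rw [← hmaple] at hx
    obtain ⟨y, hy, hyx⟩ := hx
    have hker : D (x - y) = 0 := by rw [map_sub, hyx, sub_self]
    have := hDker _ hker
    have e : x = y + (x - y) := by abel
    rw [e]
    exact add_mem hy this
  let Dq : ((periodHomologyHecke L) ⧸ (𝔪 • ⊤ : Submodule (HeckeRing0 L 2) (periodHomologyHecke L))) →ₗ[HeckeRing0 L 2]
      ((Submodule.torsionBy (HeckeRing0 L 2) (J0 L) ((2 : ℕ) : HeckeRing0 L 2)) ⧸
        (𝔪 • ⊤ : Submodule (HeckeRing0 L 2) (Submodule.torsionBy (HeckeRing0 L 2) (J0 L) ((2 : ℕ) : HeckeRing0 L 2)))) :=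
    Submodule.mapQ _ _ D (fun y hy ↦ by rw [Submodule.mem_comap, ← hmaple]; exact Submodule.mem_map_of_mem hy)
  have hDq : Function.Injective Dq := by
    rw [← LinearMap.ker_eq_bot, Submodule.eq_bot_iff]
    intro q hq
    obtain ⟨x, rfl⟩ := Submodule.Quotient.mk_surjective _ q
    rw [LinearMap.mem_ker, Submodule.mapQ_apply, Submodule.Quotient.mk_eq_zero] at hq
    exact (Submodule.Quotient.mk_eq_zero _).mpr (hinj x hq)
  have hDqsurj : Function.Surjective Dq := by
    intro q
    obtain ⟨m, rfl⟩ := Submodule.Quotient.mk_surjective _ q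
    obtain ⟨x, rfl⟩ := hDsurj m
    exact ⟨Submodule.Quotient.mk x, by rw [Submodule.mapQ_apply]⟩
  haveI : Finite ((Submodule.torsionBy (HeckeRing0 L 2) (J0 L) ((2 : ℕ) : HeckeRing0 L 2)) ⧸
      (𝔪 • ⊤ : Submodule (HeckeRing0 L 2) (Submodule.torsionBy (HeckeRing0 L 2) (J0 L) ((2 : ℕ) : HeckeRing0 L 2)))) :=
    Finite.of_surjective _ (Submodule.Quotient.mk_surjective _)
  haveI hPfin : Finite ((periodHomologyHecke L) ⧸ (𝔪 • ⊤ : Submodule (HeckeRing0 L 2) (periodHomologyHecke L))) :=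
    Finite.of_injective Dq hDq
  exact ⟨hPfin, Nat.card_congr (Equiv.ofBijective Dq ⟨hDq, hDqsurj⟩)⟩

end PeriodHomology

/-! ## §3 Socle from cosocle at a maximal ideal with `|𝕋/𝔪| = 2` -/

section Socle

variable {L : ℕ} [NeZero L]

/-- **SUB form from QUOTIENT form + a balanced left-nondegenerate pairing on `J₀(L)[2]`.** Let `𝔪 ∋ 2` be a maximal ideal of
`𝕋 = HeckeRing0 L 2` with `|𝕋/𝔪| = 2` and `dim_{𝕋/𝔪} Λ/𝔪Λ = 2` (`Λ = periodHomologyHecke L`; the cosocle / Picard reading of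
Buzzard's multiplicity one), and let `B` be a `𝕋`-balanced pairing on `M = J₀(L)[2]` with trivial left kernel (the consumed shape of
`heckeSelfDual_torsionBy_J0` at `ℓ = 2`). Then `dim_{𝕋/𝔪} J₀(L)[𝔪] = 2`: `|J₀(L)[𝔪]| = |M[𝔪]| = |M/𝔪M| = |Λ/𝔪Λ| = 4`.
[cite: DarmonDiamondTaylor1995, §1.6 Lemma 1.38 and §4.5 Thm. 4.26] -/
theorem finrank_torsionBySet_eq_two_of_cosocle_of_pairing (𝔪 : Ideal (HeckeRing0 L 2)) [h𝔪 : 𝔪.IsMaximal]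
    (h2 : (2 : HeckeRing0 L 2) ∈ 𝔪) (hq : Nat.card (HeckeRing0 L 2 ⧸ 𝔪) = 2)
    (hcos : Module.finrank (HeckeRing0 L 2 ⧸ 𝔪)
      (periodHomologyHecke L ⧸ (𝔪 • ⊤ : Submodule (HeckeRing0 L 2) (periodHomologyHecke L))) = 2)
    (B : Submodule.torsionBy (HeckeRing0 L 2) (J0 L) ((2 : ℕ) : HeckeRing0 L 2) →+
      (Submodule.torsionBy (HeckeRing0 L 2) (J0 L) ((2 : ℕ) : HeckeRing0 L 2) →+ ZMod 2))
    (hbal : ∀ (t : HeckeRing0 L 2) x y, B (t • x) y = B x (t • y)) (hleft : ∀ x, (∀ y, B x y = 0) → x = 0) :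
    Module.finrank (HeckeRing0 L 2 ⧸ 𝔪) (Submodule.torsionBySet (HeckeRing0 L 2) (J0 L) 𝔪) = 2 := by
  classical
  haveI hMfin : Finite (Submodule.torsionBy (HeckeRing0 L 2) (J0 L) ((2 : ℕ) : HeckeRing0 L 2)) :=
    J0.finite_torsionBy L (ℓ := 2) two_ne_zero
  have h22 : ((2 : ℕ) : HeckeRing0 L 2) = 2 := Nat.cast_ofNat
  letI : Field (HeckeRing0 L 2 ⧸ 𝔪) := Ideal.Quotient.field 𝔪
  -- (1) `|Λ/𝔪Λ| = 4`
  obtain ⟨hPfin, hcardPM⟩ := finite_and_natCard_quotient_periodHomologyHecke_eq (L := L) 𝔪 h2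
  haveI := hPfin
  haveI : Module.Finite (HeckeRing0 L 2 ⧸ 𝔪)
      (periodHomologyHecke L ⧸ (𝔪 • ⊤ : Submodule (HeckeRing0 L 2) (periodHomologyHecke L))) := Module.Finite.of_finite
  have hcardP : Nat.card (periodHomologyHecke L ⧸ (𝔪 • ⊤ : Submodule (HeckeRing0 L 2) (periodHomologyHecke L))) = 4 := by
    rw [Module.natCard_eq_pow_finrank (K := HeckeRing0 L 2 ⧸ 𝔪), hq, hcos]
    norm_num
  -- (2) `|M[𝔪]| = |M/𝔪M| = |Λ/𝔪Λ| = 4`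
  have h2M : ∀ x : (Submodule.torsionBy (HeckeRing0 L 2) (J0 L) ((2 : ℕ) : HeckeRing0 L 2)), (2 : ℕ) • x = 0 := fun x ↦ by
    have hx := x.2
    rw [Submodule.mem_torsionBy_iff] at hx
    apply Subtype.ext
    rw [AddSubgroupClass.coe_nsmul, ZeroMemClass.coe_zero, ← Nat.cast_smul_eq_nsmul (HeckeRing0 L 2)]
    exact hx
  have hleft' : ∀ x : (Submodule.torsionBy (HeckeRing0 L 2) (J0 L) ((2 : ℕ) : HeckeRing0 L 2)), B x = 0 → x = 0 :=
    fun x hx ↦ hleft x fun y ↦ by rw [hx, AddMonoidHom.zero_apply]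
  have hcardT : Nat.card {x : (Submodule.torsionBy (HeckeRing0 L 2) (J0 L) ((2 : ℕ) : HeckeRing0 L 2)) // ∀ t ∈ 𝔪, t • x = 0} = 4 := by
    rw [natCard_torsionBySet_eq_natCard_quotient_of_pairing h2M B hbal hleft' 𝔪, ← hcardPM, hcardP]
  -- (3) `M[𝔪] = J₀(L)[𝔪]` (as `2 ∈ 𝔪`)
  have htors_le : Submodule.torsionBySet (HeckeRing0 L 2) (J0 L) 𝔪 ≤
      (Submodule.torsionBy (HeckeRing0 L 2) (J0 L) ((2 : ℕ) : HeckeRing0 L 2)) := by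
    rw [h22]
    exact J0.torsionBySet_le_torsionBy L h2
  let e : {x : (Submodule.torsionBy (HeckeRing0 L 2) (J0 L) ((2 : ℕ) : HeckeRing0 L 2)) // ∀ t ∈ 𝔪, t • x = 0} ≃
      Submodule.torsionBySet (HeckeRing0 L 2) (J0 L) 𝔪 :=
    { toFun := fun x ↦ ⟨(x.1 : J0 L), (Submodule.mem_torsionBySet_iff _ _).mpr fun t ↦ by
        have h := congrArg Subtype.val (x.2 t t.2)
        exact h⟩
      invFun := fun j ↦ ⟨⟨(j : J0 L), htors_le j.2⟩, fun t ht ↦ Subtype.ext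
        ((Submodule.mem_torsionBySet_iff _ _).mp j.2 ⟨t, ht⟩)⟩
      left_inv := fun x ↦ rfl
      right_inv := fun j ↦ rfl }
  haveI : Finite (Submodule.torsionBySet (HeckeRing0 L 2) (J0 L) 𝔪) :=
    J0.finite_torsionBySet L two_ne_zero (by rw [← h22] at h2; exact h2)
  haveI : Module.Finite (HeckeRing0 L 2 ⧸ 𝔪) (Submodule.torsionBySet (HeckeRing0 L 2) (J0 L) 𝔪) := Module.Finite.of_finite
  have hcard4 : Nat.card (Submodule.torsionBySet (HeckeRing0 L 2) (J0 L) 𝔪) = 4 := by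
    rw [← Nat.card_congr e, hcardT]
  -- (4) `2 ^ finrank = 4 ⇒ finrank = 2`
  have hpow := Module.natCard_eq_pow_finrank (K := HeckeRing0 L 2 ⧸ 𝔪)
    (V := Submodule.torsionBySet (HeckeRing0 L 2) (J0 L) 𝔪)
  rw [hcard4, hq] at hpow
  exact (Nat.pow_right_injective le_rfl (hpow.symm.trans (by norm_num : (4 : ℕ) = 2 ^ 2)))

/-- **SUB form from QUOTIENT form, keyed to the named fact `heckeSelfDual_torsionBy_J0`** (which every caller of the tree's three
socle sites already holds): for `𝔪 ∋ 2` maximal in `HeckeRing0 L 2` with `|𝕋/𝔪| = 2`, `dim_{𝕋/𝔪} Λ/𝔪Λ = 2` implies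
`dim_{𝕋/𝔪} J₀(L)[𝔪] = 2`. USE (if the ONE Buzzard fact is re-typed in the quotient/Picard reading): each socle site
`… = hBz L hL 𝔪 h𝔪 h2 k ι ρ hU hI hS` becomes `finrank_torsionBySet_eq_two_of_cosocle_of_sd hSD 𝔪 h2 hq (hBz L hL 𝔪 h𝔪 h2 k ι ρ hU hI hS)`.
Conditional on SD; BSD is not proved by this. [cite: DarmonDiamondTaylor1995, §1.6 Lemma 1.38 and §4.5 Thm. 4.26] -/
theorem finrank_torsionBySet_eq_two_of_cosocle_of_sd (hSD : heckeSelfDual_torsionBy_J0) (𝔪 : Ideal (HeckeRing0 L 2))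
    [h𝔪 : 𝔪.IsMaximal] (h2 : (2 : HeckeRing0 L 2) ∈ 𝔪) (hq : Nat.card (HeckeRing0 L 2 ⧸ 𝔪) = 2)
    (hcos : Module.finrank (HeckeRing0 L 2 ⧸ 𝔪)
      (periodHomologyHecke L ⧸ (𝔪 • ⊤ : Submodule (HeckeRing0 L 2) (periodHomologyHecke L))) = 2) :
    Module.finrank (HeckeRing0 L 2 ⧸ 𝔪) (Submodule.torsionBySet (HeckeRing0 L 2) (J0 L) 𝔪) = 2 := by
  obtain ⟨B, hbal, hleft, -⟩ := hSD L 2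
  exact finrank_torsionBySet_eq_two_of_cosocle_of_pairing 𝔪 h2 hq hcos B hbal hleft

end Socle

end Summit.BirchSwinnertonDyer.BirchSwinnertonDyer.Theorems.ThetaLayerLambdaCongruenceAtTwo

end
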